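import Summits.ResolutionOfSingularities.ResolutionOfSingularities.Theorems.PurelyInseparableDim4EquimultipleEdge
import Literature.AlgebraicGeometry.Resolution.OrderSemicontinuityPointwise
import Literature.AlgebraicGeometry.Resolution.AlterationsLemma32
import Literature.AlgebraicGeometry.Resolution.ProjectiveSpaceRegular
import Mathlib.AlgebraicGeometry.Morphisms.FiniteType
import HarnessLib

/-!
# Purely inseparable four-folds: the marked STOP CONDITION is a statement about closed points (brick TY-3g, cell
# `res-dim4-pi`)

[OURS · counted 0] (D-0157 DOOR 2; glue between the scheme-level target frame `PIDim4.OrderReduction` —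
`IsMarkedResolution … ∧ M'.support = ∅` — and the cell's walk, whose states are CLOSED points; host item
stmt-ResolutionOfSingularities-16155, helper). Nothing here proves resolution of singularities in dimension ≥ 4 /
characteristic `p`.

* §1 (generic): on a JACOBSON scheme with REGULAR local rings the order of an ideal sheaf does not decrease under
  specialization (tree `idealOrder_le_of_specializes`) and every point specializes to a closed point
  (`nonempty_inter_closedPoints`), so `ord_x I < n` at every closed point gives it at every point
  (`idealOrder_lt_of_forall_isClosed`) and **`MarkedIdeal.support = ∅ ↔ ∀ closed x, ord_x 𝓘 < μ`**
  (`support_eq_empty_iff_forall_isClosed`).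
* §2 (the cell's blow-ups): ANY blowing up `π : W → 𝔸⁵_K` along `V(z, x_S)` is Jacobson (locally of finite type over
  `K`) and regular (smooth over `K`: tree `AffineCoordBlowup.smooth_comp`, `Scheme.IsRegular.of_smooth`) —
  `jacobsonSpace_of_isBlowup`, `isRegular_of_isBlowup`; hence **`support_transform_eq_empty_iff`**: the transformed
  marked ideal `(⟨(z^p + F), E, p⟩).transform π 𝓘Λ` has empty support iff NO CLOSED point of `W` has
  `ord σᶜ((z^p + F), p) ≥ p` — by TY-3e/TY-3f these closed points are exactly the chart points `chartImm_j (a, b)`,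
  `a^p + F′_j(b) = 0`, `IsEquimultiplePoint p S j b s` (over the centre: the `PIDim4.Edge` successors).

AI-produced formalisation, weaker than expert review. bears_on: LADDER-RESOLUTION:D157-DOOR2 (res-dim4-pi · TY-3g).
-/

set_option linter.dupNamespace false -- D-0017: single-problem summit path `Summit.<S>.<S>.…` by design

noncomputable section

open MvPolynomial Finset CategoryTheory AlgebraicGeometry Opposite

namespace Summit.ResolutionOfSingularities.ResolutionOfSingularities.Theorems.PIDim4

open Literature.AlgebraicGeometry.Resolution
open Literature.AlgebraicGeometry.Resolution.Hauser2010
open Literature.AlgebraicGeometry.Resolution.AffinePointBlowup (P A γ coord Wtop)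

namespace Equimultiple

/-! ## §1 Orders on Jacobson regular schemes are controlled by the closed points -/

section Generic

universe u

variable {X : Scheme.{u}}

/-- **Upper bounds on orders propagate from the closed points** on a Jacobson scheme with regular local rings:
if `ord_x I < n` at every CLOSED point `x`, then `ord_x I < n` at every point (a point `x` specializes to a closed
point `y ∈ cl{x}`, and `ord_x ≤ ord_y`). [cite: CossartPiltant2008, Prop. 4.2 (proof: upper semicontinuity of the order)] -/
theorem idealOrder_lt_of_forall_isClosed [JacobsonSpace X] (hX : Scheme.IsRegular X) (I : X.IdealSheafData)
    (n : ℕ∞) (h : ∀ x : X, IsClosed ({x} : Set X) → idealOrder I x < n) (x : X) : idealOrder I x < n := by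
  obtain ⟨y, hyx, hy⟩ := nonempty_inter_closedPoints (Z := closure ({x} : Set X)) ⟨x, subset_closure rfl⟩
    isClosed_closure.isLocallyClosed
  have hsp : x ⤳ y := specializes_iff_mem_closure.mpr hyx
  haveI := hX y
  exact lt_of_le_of_lt (idealOrder_le_of_specializes hsp I) (h y ((mem_closedPoints_iff).mp hy))

/-- **The marked STOP CONDITION on closed points**: on a Jacobson scheme with regular local rings,
`supp(X, 𝓘, E, μ) = ∅ ↔ ord_x 𝓘 < μ` at every CLOSED point `x` (BGMW Def. 3.1.2 / 3.1.3 (6)).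
[cite: BierstoneGrigorievMilmanWlodarczyk2011, Def. 3.1.2 and Def. 3.1.3 (6)] -/
theorem support_eq_empty_iff_forall_isClosed [JacobsonSpace X] (hX : Scheme.IsRegular X) (M : MarkedIdeal X) :
    M.support = ∅ ↔ ∀ x : X, IsClosed ({x} : Set X) → idealOrder M.ideal x < M.mult := by
  constructor
  · intro h x _
    by_contra hle
    rw [not_lt] at hle
    have : x ∈ M.support := hle
    rw [h] at this
    exact this
  · intro h
    exact Set.eq_empty_of_forall_notMem fun x hx =>
      (not_le.mpr (idealOrder_lt_of_forall_isClosed hX M.ideal M.mult h x)) hx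

end Generic

/-! ## §2 The blow-ups of `𝔸⁵_K` along `V(z, x_S)` -/

section Blowup

variable {K : Type} [Field K] {p : ℕ} [hp : Fact p.Prime] [CharP K p]
variable {S : Finset (Fin 4)} {W : Scheme.{0}} {π : W ⟶ P 4 K}

omit hp [CharP K p] in
/-- A blowing up of `𝔸⁵_K` along a coordinate subspace is a Jacobson scheme (locally of finite type over `K`).
[cite: StacksProject, Tag 01P4 (schemes locally of finite type over a field are Jacobson)] -/
theorem jacobsonSpace_of_isBlowup {Λ : Set (Fin (4 + 1))} (hπ : IsBlowup π (AffineCoordBlowup.𝓘Λ 4 K Λ)) :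
    JacobsonSpace W := by
  haveI := AffineCoordBlowup.locallyOfFiniteType_comp hπ
  exact LocallyOfFiniteType.jacobsonSpace (π ≫ AffinePointBlowup.f 4 K)

omit hp [CharP K p] in
/-- A blowing up of `𝔸⁵_K` along a coordinate subspace is a regular scheme (it is smooth over `K`: every chart is an
affine space). [cite: Grothendieck1967, Prop. 17.5.8 (iii) (PDF p. 69)] -/
theorem isRegular_of_isBlowup {Λ : Set (Fin (4 + 1))} (hπ : IsBlowup π (AffineCoordBlowup.𝓘Λ 4 K Λ)) :
    Scheme.IsRegular W := by
  haveI := AffineCoordBlowup.smooth_comp hπ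
  exact Scheme.IsRegular.of_smooth (π ≫ AffinePointBlowup.f 4 K) (Scheme.isRegular_Spec (CommRingCat.of K))

omit hp [CharP K p] in
/-- **The stop condition of the target frame, on closed points.** For ANY blowing up `π : W → 𝔸⁵_K` along
`V(z, x_S)` and any boundary `E`, the transformed marked ideal `(⟨(z^p + F)·𝒪, E, p⟩).transform π 𝓘Λ` has EMPTY
support iff no CLOSED point of `W` is a point of order `≥ p` of the controlled transform `σᶜ((z^p + F), p)`.
[cite: BierstoneGrigorievMilmanWlodarczyk2011, Def. 3.1.3 (3) and (6)] -/
theorem support_transform_eq_empty_iff (F : MvPolynomial (Fin 4) K) (E : List (P 4 K).IdealSheafData)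
    (hπ : IsBlowup π (AffineCoordBlowup.𝓘Λ 4 K (insert 0 (Fin.succ '' (S : Set (Fin 4)))))) :
    ((⟨hypSheaf p F, E, p⟩ : MarkedIdeal (P 4 K)).transform π
        (AffineCoordBlowup.𝓘Λ 4 K (insert 0 (Fin.succ '' (S : Set (Fin 4)))))).support = ∅ ↔
      ∀ w : W, IsClosed ({w} : Set W) →
        idealOrder (controlledTransform π (AffineCoordBlowup.𝓘Λ 4 K (insert 0 (Fin.succ '' (S : Set (Fin 4)))))
          (hypSheaf p F) p) w < p := by
  haveI := jacobsonSpace_of_isBlowup hπ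
  rw [support_eq_empty_iff_forall_isClosed (isRegular_of_isBlowup hπ)]
  rfl

/-- **… and with the chart dictionary** (`K` algebraically closed, `p ≤ ord_{(x_S)} F`): the support is empty iff
no `x_j`-chart (`j ∈ S`) contains a CLOSED rational point `(a, b)` with `a^p + F′_j(b) = 0` and
`IsEquimultiplePoint p S j b s` (TY-3e synthesis). In particular a non-empty support over the centre produces a
`PIDim4.Edge` successor (TY-3f `exists_edge_of_le_idealOrder`). [cite: Hauser2010, §F (equiconstant points)] -/
theorem support_transform_eq_empty_iff_forall_chart [IsAlgClosed K] (s : State K)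
    (hperm : (p : ℕ∞) ≤ CentreBlowup.ordAlong S s.F) (E : List (P 4 K).IdealSheafData)
    (hπ : IsBlowup π (AffineCoordBlowup.𝓘Λ 4 K (insert 0 (Fin.succ '' (S : Set (Fin 4)))))) :
    ((⟨hypSheaf p s.F, E, p⟩ : MarkedIdeal (P 4 K)).transform π
        (AffineCoordBlowup.𝓘Λ 4 K (insert 0 (Fin.succ '' (S : Set (Fin 4)))))).support = ∅ ↔
      ∀ (j : Fin 4) (hj : j ∈ S) (x : P 4 K) (a : K) (b : Fin 4 → K),
        IsClosed ({AffineCoordBlowup.chartImm hπ (ChartDictionary.succ_mem_centreVars hj) x} : Set W) →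
          x.asIdeal = MvPolynomial.vanishingIdeal K {(Fin.cons a b : Fin (4 + 1) → K)} →
            a ^ p + eval b (CentreBlowup.chartTransform p S j s.F) = 0 →
              ¬ CentreBlowup.IsEquimultiplePoint p S j b s := by
  rw [support_transform_eq_empty_iff s.F E hπ]
  constructor
  · intro h j hj x a b hw hx hab heq
    have hord := (isEquimultiplePoint_iff_idealOrder_controlledTransform_ge hj s hperm hπ b a hab hx).mp heq
    exact (not_le.mpr (h _ hw)) hord
  · intro h w hw
    by_contra hge
    rw [not_lt] at hge
    obtain ⟨j, hj, x, a, b, hxw, hx, hab, heq⟩ :=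
      (le_idealOrder_controlledTransform_iff_exists_chart s hperm hπ hw).mp hge
    subst hxw
    exact h j hj x a b hw hx hab heq

end Blowup

end Equimultiple

end Summit.ResolutionOfSingularities.ResolutionOfSingularities.Theorems.PIDim4

end
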